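import Literature.MathematicalPhysics.QuantumLattice.SpinPartialTrace
import Literature.LinearAlgebra.Matrix.GradedCompression
import HarnessLib

/-!
# Charge-sector compression of spin-system density matrices commutes with taking marginals

For a finite quantum spin system (`Op Y q = B(⊗_{y∈Y} ℂ^q)`, product-basis configurations
`TensorIndex Y q = Y → Fin q`) and a **grading by a local additive charge**
`k ↦ Σ_{y∈Y} c_y(k_y)` (`siteChargeGrading c`, values in a cancellative additive monoid `G` — particle number,
magnetisation, a STAGGERED magnetisation `Σ_y (−1)^y s^z_y`, or a tuple of such), the compression of a density
matrix onto the charge sectors (`gradedCompress`, the unrecorded charge measurement `ρ ↦ Σ_Q P_Q ρ P_Q`,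
Nielsen–Chuang eq. (11.65); the symmetry sectors of Kull–Schuch–Dive–Navascués §3.3) COMMUTES WITH THE PARTIAL
TRACE along any site injection `φ : X ↪ Y`: the marginal on `X` of the sector-compressed state is the
sector-compressed marginal, for the RESTRICTED charge `c ∘ φ`
(`spinPartialTrace_gradedCompress_siteChargeGrading`). The mechanism (`spinPartialTrace_gradedCompress_of_add`)
is that the charge splits as (charge on `φ(X)`) + (charge off `φ(X)`), the partial trace pairs only
configurations that agree off `φ(X)`, and the off-range part cancels. Consequence for the KSDN / LTI window
relaxations (Kull et al. §2.1–2.2, §3.3): if `ρ` on a window satisfies the local-translation-invariance row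
`tr_L ρ = tr_R ρ`, then so does its sector compression for any local additive charge whose restrictions to the
two sub-windows agree up to an injective relabelling of `G` (e.g. up to a global sign, the staggered case:
`gradedCompress_neg`) — so sector zeros may be imposed on the window variable without loss
(`spinPartialTrace_gradedCompress_eq_of_eq`). No `sorry`, no named fact; the one definition (`siteChargeGrading`) has a body.

## References
* I. Kull, N. Schuch, B. Dive, M. Navascués, *Lower bounding ground-state energies of local Hamiltonians through
  the renormalization group*, Phys. Rev. X 14, 021008 (2024) = arXiv:2212.03014, §2.1–2.2 (LTI rows
  `tr_L ρ^{(m)} = tr_R ρ^{(m)}`), §3.3 (symmetries: variables block diagonal in a conserved charge).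
  [cite: KullEtAl2024, §3.3]
* M. A. Nielsen, I. L. Chuang, *Quantum Computation and Quantum Information* (CUP 2010), §11.3.3 eq. (11.65)
  (`ρ' = Σ_i P_i ρ P_i`), §2.4.3 eqs. (2.177)–(2.180) (reduced density operator). [cite: NielsenChuang2010, §11.3.3]

## Tree
Uses `spinPartialTrace` / `spinPartialTrace_apply` / `spinEmbed_apply` (SpinPartialTrace, SpinEmbedding) and
`gradedCompress` with its API (LinearAlgebra/Matrix/GradedCompression).
-/

noncomputable section

namespace Literature.MathematicalPhysics.QuantumLattice

open _root_.Matrix Finset Literature.LinearAlgebra.Matrix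
open scoped BigOperators

variable {X Y : Type*} {q : ℕ} {G : Type*}

/-! ### The matrix unit embedded along `φ` pairs only configurations that agree off the range -/

/-- Support of the embedded matrix unit `Γ_φ(|s⟩⟨t|)`: a non-zero entry at `(k, k')` forces `k` and `k'` to
agree off `φ(X)` and to restrict to `s` and `t` on it. [cite: NielsenChuang2010, §2.4.3 eq. (2.178)] -/
theorem spinEmbed_single_apply_ne_zero [Fintype X] [DecidableEq X] [Fintype Y] [DecidableEq Y] (φ : X ↪ Y)
    (s t : TensorIndex X q) (k k' : TensorIndex Y q)
    (h : spinEmbed φ (Matrix.single s t (1 : ℂ)) k k' ≠ 0) :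
    (∀ y, y ∉ Set.range φ → k y = k' y) ∧ (fun x => k (φ x)) = s ∧ (fun x => k' (φ x)) = t := by
  rw [spinEmbed_apply] at h
  by_cases hagree : ∀ y, y ∉ Set.range φ → k y = k' y
  · rw [if_pos hagree, Matrix.single_apply] at h
    by_cases hst : s = (fun x => k (φ x)) ∧ t = (fun x => k' (φ x))
    · exact ⟨hagree, hst.1.symm, hst.2.symm⟩
    · exact absurd (if_neg hst) h
  · exact absurd (if_neg hagree) h

/-! ### Compression along a charge that splits as (on-range part) + (off-range part) -/

section Split

variable [Fintype X] [DecidableEq X] [Fintype Y] [DecidableEq Y] [DecidableEq G] [Add G] [IsRightCancelAdd G]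

/-- **Sector compression commutes with the partial trace** when the grading of the big system is
`k ↦ gX (k ∘ φ) + gR k` with `gR` depending only on the configuration OFF the range of `φ`:
`tr_{Y∖X} (Σ_Q P_Q σ P_Q) = Σ_{Q'} P'_{Q'} (tr_{Y∖X} σ) P'_{Q'}` with `P'` the sector projections of `gX`.
[cite: KullEtAl2024, §3.3] -/
theorem spinPartialTrace_gradedCompress_of_add (φ : X ↪ Y) (gX : TensorIndex X q → G)
    (gR : TensorIndex Y q → G)
    (hR : ∀ k k' : TensorIndex Y q, (∀ y, y ∉ Set.range φ → k y = k' y) → gR k = gR k') (σ : Op Y q) :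
    spinPartialTrace φ (gradedCompress (fun k : TensorIndex Y q => gX (fun x => k (φ x)) + gR k) σ)
      = gradedCompress gX (spinPartialTrace φ σ) := by
  ext t s
  rw [gradedCompress_apply, spinPartialTrace_apply, spinPartialTrace_apply]
  simp only [Matrix.trace, Matrix.diag_apply, Matrix.mul_apply, gradedCompress_apply]
  by_cases h : gX t = gX s
  · rw [if_pos h]
    refine Finset.sum_congr rfl fun k _ => Finset.sum_congr rfl fun k' _ => ?_
    by_cases hE : spinEmbed φ (Matrix.single s t (1 : ℂ)) k k' = 0
    · rw [hE, zero_mul, zero_mul]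
    · obtain ⟨hagree, hks, hkt⟩ := spinEmbed_single_apply_ne_zero φ s t k k' hE
      have hgg : gX (fun x => k' (φ x)) + gR k' = gX (fun x => k (φ x)) + gR k := by
        rw [hkt, hks, h, hR k k' hagree]
      rw [if_pos hgg]
  · rw [if_neg h]
    refine Finset.sum_eq_zero fun k _ => Finset.sum_eq_zero fun k' _ => ?_
    by_cases hE : spinEmbed φ (Matrix.single s t (1 : ℂ)) k k' = 0
    · rw [hE, zero_mul]
    · obtain ⟨hagree, hks, hkt⟩ := spinEmbed_single_apply_ne_zero φ s t k k' hE
      have hgg : gX (fun x => k' (φ x)) + gR k' ≠ gX (fun x => k (φ x)) + gR k := by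
        rw [hkt, hks, hR k k' hagree]
        exact fun e => h (add_right_cancel e)
      rw [if_neg hgg, mul_zero]

end Split

/-! ### Local additive charges -/

section SiteCharge

variable [Fintype Y] [AddCommMonoid G]

/-- **Grading by a local additive charge**: `k ↦ Σ_{y} c_y(k_y)` for single-site charge tables
`c : Y → Fin q → G` (e.g. `c_y(σ) = n(σ)` particle number, `c_y(σ) = (−1)^y s^z(σ)` staggered magnetisation,
or a tuple of such in a product monoid). [cite: KullEtAl2024, §3.3] -/
def siteChargeGrading (c : Y → Fin q → G) (k : TensorIndex Y q) : G :=
  ∑ y, c y (k y)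

/-- Unfolding. [cite: KullEtAl2024, §3.3] -/
theorem siteChargeGrading_apply (c : Y → Fin q → G) (k : TensorIndex Y q) :
    siteChargeGrading c k = ∑ y, c y (k y) := rfl

/-- The local charge splits along `φ : X ↪ Y` into the charge of the restricted configuration for the
restricted table `c ∘ φ` plus the charge carried off the range. [cite: KullEtAl2024, §3.3] -/
theorem siteChargeGrading_eq_add [Fintype X] [DecidableEq Y] (φ : X ↪ Y) (c : Y → Fin q → G)
    (k : TensorIndex Y q) :
    siteChargeGrading c k
      = siteChargeGrading (fun x => c (φ x)) (fun x => k (φ x))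
        + ∑ y ∈ (Finset.univ.map φ)ᶜ, c y (k y) := by
  rw [siteChargeGrading_apply, siteChargeGrading_apply, ← Finset.sum_add_sum_compl (Finset.univ.map φ),
    Finset.sum_map]

/-- The off-range charge depends only on the off-range configuration. [cite: KullEtAl2024, §3.3] -/
theorem sum_compl_charge_eq_of_agree [Fintype X] [DecidableEq Y] (φ : X ↪ Y) (c : Y → Fin q → G)
    {k k' : TensorIndex Y q}
    (h : ∀ y, y ∉ Set.range φ → k y = k' y) :
    ∑ y ∈ (Finset.univ.map φ)ᶜ, c y (k y) = ∑ y ∈ (Finset.univ.map φ)ᶜ, c y (k' y) := by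
  refine Finset.sum_congr rfl fun y hy => ?_
  rw [h y]
  intro hyr
  rw [Finset.mem_compl] at hy
  obtain ⟨x, rfl⟩ := hyr
  exact hy (Finset.mem_map_of_mem φ (Finset.mem_univ x))

variable [Fintype X] [DecidableEq X] [DecidableEq Y] [DecidableEq G] [IsRightCancelAdd G]

/-- **Marginals of a charge-sector-compressed state are the sector-compressed marginals** (restricted
charge table): `tr_{Y∖X} (gradedCompress (Σ_y c_y) σ) = gradedCompress (Σ_{x} c_{φ x}) (tr_{Y∖X} σ)`.
[cite: KullEtAl2024, §3.3] -/
theorem spinPartialTrace_gradedCompress_siteChargeGrading (φ : X ↪ Y) (c : Y → Fin q → G) (σ : Op Y q) :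
    spinPartialTrace φ (gradedCompress (siteChargeGrading c) σ)
      = gradedCompress (siteChargeGrading fun x => c (φ x)) (spinPartialTrace φ σ) := by
  have e : siteChargeGrading c
      = fun k : TensorIndex Y q => siteChargeGrading (fun x => c (φ x)) (fun x => k (φ x))
          + ∑ y ∈ (Finset.univ.map φ)ᶜ, c y (k y) :=
    funext fun k => siteChargeGrading_eq_add φ c k
  rw [e]
  exact spinPartialTrace_gradedCompress_of_add φ _ _ (fun k k' h => sum_compl_charge_eq_of_agree φ c h) σ

/-- **Sector zeros cost nothing on an LTI-type row.** If two marginals of `σ` agree,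
`tr_{Y∖φ(X)} σ = tr_{Y∖ψ(X)} σ`, and the restricted charge tables agree up to an injective relabelling `f`
of the charge monoid (`c ∘ ψ = f ∘ (c ∘ φ)` pointwise — `f = id` for an ordinary conserved charge,
`f = −id` for a staggered one when `φ(X)` and `ψ(X)` are shifted by one site), then the same two marginals of
the compressed state `gradedCompress (siteChargeGrading c) σ` agree as well. [cite: KullEtAl2024, §2.2, §3.3] -/
theorem spinPartialTrace_gradedCompress_eq_of_eq (φ ψ : X ↪ Y) (c : Y → Fin q → G) {f : G → G}
    (hf : Function.Injective f) (hadd : ∀ a b, f (a + b) = f a + f b) (h0 : f 0 = 0)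
    (hc : ∀ x a, c (ψ x) a = f (c (φ x) a)) {σ : Op Y q}
    (hσ : spinPartialTrace φ σ = spinPartialTrace ψ σ) :
    spinPartialTrace φ (gradedCompress (siteChargeGrading c) σ)
      = spinPartialTrace ψ (gradedCompress (siteChargeGrading c) σ) := by
  rw [spinPartialTrace_gradedCompress_siteChargeGrading, spinPartialTrace_gradedCompress_siteChargeGrading, hσ]
  let F : G →+ G := { toFun := f, map_zero' := h0, map_add' := hadd }
  have e : siteChargeGrading (fun x => c (ψ x)) = f ∘ siteChargeGrading (fun x => c (φ x)) := by
    funext k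
    simp only [Function.comp_apply, siteChargeGrading_apply, hc]
    exact (map_sum F (fun x => c (φ x) (k x)) Finset.univ).symm
  rw [e, gradedCompress_comp_of_injective hf]

end SiteCharge

end Literature.MathematicalPhysics.QuantumLattice
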